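import Literature.Computability.FineGrained.ForcedVariableRenaming
import Literature.Computability.FineGrained.IPRenameLoops
import Literature.Computability.FineGrained.SparsifierRoutines
import Literature.Computability.Complexity.StackUnaryBits
import HarnessLib

/-!
# The renaming machine of Impagliazzo–Paturi's Lemma 2, I: truth-table CNF emission

Family `fine-grained` (trunk T-CPLX-FINE). Impagliazzo–Paturi, *On the complexity of k-SAT*,
JCSS 62 (2001), Lemma 2 (p. 373) reduces `k`-SAT to `k'`-SAT on fewer variables; its
combinatorial half is proved in `ForcedVariableRenaming.lean` (`IPRename.reduce`,
`IPRename.reduceList`), and the assembly of Theorem 3 (`s_k ≤ (1 - d/k) s_∞`,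
`satExponent_le_satExponentLimit_of_two_machines`, `KSatExponentGapProofs.lean`) now rests on a
single undischarged named fact, the *machine* half `ipRename_reduceList_computable`
(`IPLemma2Assembly.lean`): a time-bounded `Turing.FinTM2` computing `IPRename.reduceList`
literally. That machine is written as a structured stack program over the alphabet `Γ'` of the
k-CNF encoding (`Literature.Computability.Complexity.ACom`, `SymbolPrograms.lean`; toolkit
`IPRenameRoutines.lean`, `IPRenameLoops.lean`, `SparsifierRoutines.lean`). Every clause of a
reduced formula `IPRename.reduce P φ` is a clause of a *truth-table CNF* `IPRename.cnf g V`
(one clause `IPRename.clauseOf V bs` per falsifying tuple `bs ∈ IPRename.tuples |V|` of a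
Boolean function `g` of the variables `V`). This file provides the program writing such a CNF
around an arbitrary *evaluator* sub-program for `g`, with its specification:

* `IPRename.tuples_eq_map_natBits` — the tuples of `IPRename.tuples m` are the numbers `< 2^m`
  in binary (the tree's fixed-width digit function `Complexity.natBits`, `StackUnaryBits.lean`,
  least significant digit first) in counting order, so that the enumeration is a fixed-width
  binary counter (`IPRename.bsucc` = the carry pass `TokConv.ib`/`TokConv.co` of
  `TokenStreams.lean` with carry in; `IPRename.bsucc_natBits`: the successor of `natBits m i` is
  `natBits m (i+1)`, carrying out exactly at `i + 1 = 2^m`);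
  `IPRename.cnf_eq_emitted` — `cnf g V` as the clauses emitted along the count;
* the register bank `TB` and the representation: the variable list `V` and the current tuple
  `bs` share ONE register `vt` holding the clause body `cbody (V.zip bs)` (`SparsifierRoutines`:
  each literal `(v, b)` as `bit b, binary digits of v, comma`), so that emission, increment and
  (in part II) the evaluator's lookups are single passes over `vt`;
* `flipEmit` / `runs_flipEmit` — push `encodeClause (clauseOf V bs)` (the literals of `vt` with
  flipped polarities) reversed onto the accumulator `acc`, keeping `vt`;
* `incPass` / `runs_incPass`, `incLits_true_zip` — replace the tuple by its binary successor
  (ripple carry over the polarity bits of the successive entries), carry out in `cy`;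
* `cnfLoop E` / `runs_cnfLoop`, `runs_cnfLoop_cnf` — **main result**: on the joint register file
  `TB ⊕ κ`, for any evaluator `E` that, finding `cbody (V.zip bs)` in `vt`, raises the flag `g`
  iff `g (asg V bs)` within `cE` steps and touches nothing else, the loop started on the all-false
  tuple pushes `wFam (IPRename.cnf g V)` reversed onto `acc` and stops after `2^{|V|}` rounds,
  within `(cE + 22 · idxLen V + 14) · 2^{|V|} + 1` steps (`idxLen V = Σ_v (|encodeNat v| + 2)`).

Design: routines are verified on the small bank `TB` (store constructor `tbSt` with `simp`
lemmas) and the loop is stated on `TB ⊕ κ` with stores `Sum.elim`, the evaluator living on the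
right summand and reading `vt` on the left (`ACom.Runs.inl` transports the bank's routines);
no distinctness hypotheses between registers are needed. Part II (the evaluators for
`IPRename.gClause` / `IPRename.theta` over precomputed forcing tables, and the construction of
`V = depClause … / depTheta …` in `vt`) and the assembly follow in sibling files.

## References

* R. Impagliazzo, R. Paturi, *On the complexity of k-SAT*, J. Comput. System Sci. 62 (2001)
  367–375, doi:10.1006/jcss.2000.1727: Lemma 2 (p. 373) and its "Moreover" sentence (the
  reduction is computable in time `poly(n) 2^{2εn}`), pp. 371–372 (the formulas `Φ_f` as CNFs of
  functions of few variables). (Not held; acquisition request acq-00143.)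
* D. E. Knuth, *The Art of Computer Programming*, vol. 2, 3rd ed., Addison-Wesley 1997, §4.3.1
  (addition with carry propagation; the tuple increment).
* T. Nipkow, G. Klein, *Concrete Semantics with Isabelle/HOL*, Springer 2014, Ch. 7 (big-step
  reasoning about loops, as in `SymbolPrograms.lean`).
-/

namespace Literature.Computability.FineGrained.IPRename

/-! ### Boolean tuples as binary counting -/

/-- The digits of an even number (`Complexity.natBits`, `StackUnaryBits.lean`, is the tree's
fixed-width least-significant-first digit function). [folklore] -/
theorem natBits_succ_two_mul (m i : ℕ) : Complexity.natBits (m + 1) (2 * i) = false :: Complexity.natBits m i := by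
  simp [Complexity.natBits, Nat.mul_mod_right]

/-- The digits of an odd number. [folklore] -/
theorem natBits_succ_two_mul_add_one (m i : ℕ) :
    Complexity.natBits (m + 1) (2 * i + 1) = true :: Complexity.natBits m i := by
  have h1 : (2 * i + 1) % 2 = 1 := by omega
  have h2 : (2 * i + 1) / 2 = i := by omega
  simp [Complexity.natBits, h1, h2]

/-- The digits of `0`. [folklore] -/
theorem natBits_zero : ∀ m : ℕ, Complexity.natBits m 0 = List.replicate m false
  | 0 => rfl
  | m + 1 => by simp [Complexity.natBits, natBits_zero m, List.replicate_succ]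

/-- The digits of `2^m` modulo `2^m`. [folklore] -/
theorem natBits_two_pow : ∀ m : ℕ, Complexity.natBits m (2 ^ m) = List.replicate m false
  | 0 => rfl
  | m + 1 => by
    rw [pow_succ, mul_comm, natBits_succ_two_mul, natBits_two_pow m, List.replicate_succ]

/-- `[0, 2N)` listed by pairs `2i, 2i+1`. [folklore] -/
theorem range_two_mul (N : ℕ) :
    List.range (2 * N) = (List.range N).flatMap fun i => [2 * i, 2 * i + 1] := by
  induction N with
  | zero => rfl
  | succ N ih =>
    rw [show 2 * (N + 1) = 2 * N + 1 + 1 by ring, List.range_succ, List.range_succ, ih,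
      List.range_succ, List.flatMap_append]
    simp

/-- **The tuples of `IPRename.tuples m` are the numbers `< 2^m` in binary, in counting order**
(least significant digit first). [folklore] -/
theorem tuples_eq_map_natBits : ∀ m : ℕ, tuples m = (List.range (2 ^ m)).map (Complexity.natBits m)
  | 0 => rfl
  | m + 1 => by
    rw [tuples, tuples_eq_map_natBits m, pow_succ, mul_comm, range_two_mul, List.map_flatMap,
      List.flatMap_map]
    refine List.flatMap_congr fun i _ => ?_
    simp [natBits_succ_two_mul, natBits_succ_two_mul_add_one]

/-- Binary successor of a fixed-width tuple (least significant digit first) with the carry out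
of the most significant position: the carry pass `TokConv.ib` / `TokConv.co` of
`TokenStreams.lean` with incoming carry `true` (Knuth, TAOCP 2, §4.3.1). [folklore] -/
def bsucc (bs : List Bool) : List Bool × Bool :=
  (Complexity.TokConv.ib true bs, Complexity.TokConv.co true bs)

/-- A carry pass without incoming carry writes the word back. [folklore] -/
theorem ib_false : ∀ w : List Bool, Complexity.TokConv.ib false w = w
  | [] => rfl
  | b :: w => by rw [Complexity.TokConv.ib, Bool.and_false, ib_false w, Bool.xor_false]

/-- A carry pass without incoming carry has no outgoing carry. [folklore] -/
theorem co_false : ∀ w : List Bool, Complexity.TokConv.co false w = false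
  | [] => rfl
  | b :: w => by rw [Complexity.TokConv.co, Bool.and_false, co_false w]

/-- `bsucc` on the empty tuple. [folklore] -/
@[simp] theorem bsucc_nil : bsucc [] = ([], true) := rfl

/-- `bsucc` absorbs the carry at a `false`. [folklore] -/
@[simp] theorem bsucc_false_cons (r : List Bool) : bsucc (false :: r) = (true :: r, false) := by
  simp [bsucc, Complexity.TokConv.ib, Complexity.TokConv.co, ib_false, co_false]

/-- `bsucc` propagates the carry through a `true`. [folklore] -/
@[simp] theorem bsucc_true_cons (r : List Bool) :
    bsucc (true :: r) = (false :: (bsucc r).1, (bsucc r).2) := by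
  simp [bsucc, Complexity.TokConv.ib, Complexity.TokConv.co]

/-- **The successor steps through the enumeration**: `bsucc (Complexity.natBits m i) = Complexity.natBits m (i+1)`, with
carry out exactly when `i + 1 ≡ 0 (mod 2^m)`. [folklore] -/
theorem bsucc_natBits : ∀ (m i : ℕ),
    bsucc (Complexity.natBits m i) = (Complexity.natBits m (i + 1), decide ((i + 1) % 2 ^ m = 0))
  | 0, i => by simp [Complexity.natBits, Nat.mod_one]
  | m + 1, i => by
    rcases Nat.mod_two_eq_zero_or_one i with h0 | h1
    · -- even: no carry
      have e1 : Complexity.natBits (m + 1) i = false :: Complexity.natBits m (i / 2) := by simp [Complexity.natBits, h0]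
      have e2 : Complexity.natBits (m + 1) (i + 1) = true :: Complexity.natBits m (i / 2) := by
        have : (i + 1) % 2 = 1 := by omega
        have : (i + 1) / 2 = i / 2 := by omega
        simp [Complexity.natBits, *]
      have e3 : (i + 1) % 2 ^ (m + 1) ≠ 0 := by
        intro h
        have h2 : (i + 1) % 2 ^ (m + 1) % 2 = (i + 1) % 2 :=
          Nat.mod_mod_of_dvd _ (dvd_pow_self 2 (Nat.succ_ne_zero m))
        rw [h] at h2
        omega
      rw [e1, bsucc_false_cons, e2]
      simp [e3]
    · -- odd: carry into the tail
      have e1 : Complexity.natBits (m + 1) i = true :: Complexity.natBits m (i / 2) := by simp [Complexity.natBits, h1]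
      have e2 : Complexity.natBits (m + 1) (i + 1) = false :: Complexity.natBits m (i / 2 + 1) := by
        have : (i + 1) % 2 = 0 := by omega
        have : (i + 1) / 2 = i / 2 + 1 := by omega
        simp [Complexity.natBits, *]
      have e3 : ((i + 1) % 2 ^ (m + 1) = 0) ↔ ((i / 2 + 1) % 2 ^ m = 0) := by
        have hi : i + 1 = 2 * (i / 2 + 1) := by omega
        rw [hi, pow_succ, mul_comm (2 ^ m) 2, Nat.mul_mod_mul_left]
        omega
      rw [e1, bsucc_true_cons, bsucc_natBits m (i / 2), e2]
      simp only [Prod.mk.injEq, true_and]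
      by_cases h : (i / 2 + 1) % 2 ^ m = 0
      · rw [decide_eq_true h, decide_eq_true (e3.2 h)]
      · rw [decide_eq_false h, decide_eq_false (fun h' => h (e3.1 h'))]

/-- No carry out before the last tuple. [folklore] -/
theorem bsucc_natBits_of_lt {m i : ℕ} (h : i + 1 < 2 ^ m) :
    bsucc (Complexity.natBits m i) = (Complexity.natBits m (i + 1), false) := by
  rw [bsucc_natBits, Nat.mod_eq_of_lt h]
  simp

/-- Carry out at the last tuple, wrapping to the first. [folklore] -/
theorem bsucc_natBits_last (m : ℕ) :
    bsucc (Complexity.natBits m (2 ^ m - 1)) = (List.replicate m false, true) := by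
  have h : 2 ^ m - 1 + 1 = 2 ^ m := Nat.sub_add_cancel Nat.one_le_two_pow
  rw [bsucc_natBits, h, ← natBits_two_pow m]
  simp

/-! ### The truth-table CNF along the counting enumeration -/

/-- `IPRename.cnf g V` enumerated by counting. [folklore] -/
theorem cnf_eq_filterMap_range (g : (ℕ → Bool) → Bool) (V : List ℕ) :
    cnf g V = (List.range (2 ^ V.length)).filterMap fun i =>
      if g (asg V (Complexity.natBits V.length i)) then none else some (clauseOf V (Complexity.natBits V.length i)) := by
  rw [cnf, tuples_eq_map_natBits, List.filterMap_map]
  rfl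

/-- The clauses emitted for the first `n` tuples, given the evaluation results `gv i` of the
Boolean function at the `i`-th tuple (a clause for every falsifying tuple). [folklore] -/
def emitted (V : List ℕ) (gv : ℕ → Bool) (n : ℕ) : List (List (ℕ × Bool)) :=
  (List.range n).filterMap fun i => if gv i then none else some (clauseOf V (Complexity.natBits V.length i))

/-- Nothing is emitted before the first tuple. [folklore] -/
theorem emitted_zero (V : List ℕ) (gv : ℕ → Bool) : emitted V gv 0 = [] := rfl

/-- One more tuple. [folklore] -/
theorem emitted_succ (V : List ℕ) (gv : ℕ → Bool) (n : ℕ) :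
    emitted V gv (n + 1) =
      emitted V gv n ++ if gv n then [] else [clauseOf V (Complexity.natBits V.length n)] := by
  rw [emitted, List.range_succ, List.filterMap_append]
  simp only [emitted, List.filterMap_cons, List.filterMap_nil]
  cases gv n <;> simp

/-- `IPRename.cnf g V` is what is emitted over all `2^{|V|}` tuples. [folklore] -/
theorem cnf_eq_emitted (g : (ℕ → Bool) → Bool) (V : List ℕ) :
    cnf g V = emitted V (fun i => g (asg V (Complexity.natBits V.length i))) (2 ^ V.length) :=
  cnf_eq_filterMap_range g V

/-- `clauseOf V bs` is the literal list `V.zip bs` with flipped polarities. [folklore] -/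
theorem clauseOf_eq_map_zip (V : List ℕ) (bs : List Bool) :
    clauseOf V bs = (V.zip bs).map fun l => (l.1, !l.2) := by
  rw [clauseOf, List.zip, List.map_zipWith]

end Literature.Computability.FineGrained.IPRename

namespace Literature.Computability.FineGrained.IPRenameM

open _root_.Computability Complexity Complexity.ACom Sparsifier IPRename

/-! ### The register bank of the emission loop -/

/-- The registers of the truth-table emission loop: `vt` holds the variable list with the current
tuple as polarities (the clause body `cbody (V.zip bs)`), `acc` is the output accumulator
(reversed), `g` the evaluator's answer flag, `go` the while flag, `cy` the carry flag, `md` the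
mode flag of the passes (armed inside an entry), `tmp` the stream target of the passes.
[folklore] -/
inductive TB where
  | vt | acc | g | go | cy | md | tmp
  deriving DecidableEq, Fintype

/-- The store of the bank with given register contents. [folklore] -/
@[simp] def tbSt (vt acc g go cy md tmp : List Γ') : AStore Γ' TB
  | TB.vt => vt
  | TB.acc => acc
  | TB.g => g
  | TB.go => go
  | TB.cy => cy
  | TB.md => md
  | TB.tmp => tmp

/-- Updating `vt`. [folklore] -/
@[simp] theorem update_tbSt_vt (vt acc g go cy md tmp w : List Γ') :
    Function.update (tbSt vt acc g go cy md tmp) TB.vt w = tbSt w acc g go cy md tmp := by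
  funext r; cases r <;> rfl
/-- Updating `acc`. [folklore] -/
@[simp] theorem update_tbSt_acc (vt acc g go cy md tmp w : List Γ') :
    Function.update (tbSt vt acc g go cy md tmp) TB.acc w = tbSt vt w g go cy md tmp := by
  funext r; cases r <;> rfl
/-- Updating `g`. [folklore] -/
@[simp] theorem update_tbSt_g (vt acc g go cy md tmp w : List Γ') :
    Function.update (tbSt vt acc g go cy md tmp) TB.g w = tbSt vt acc w go cy md tmp := by
  funext r; cases r <;> rfl
/-- Updating `go`. [folklore] -/
@[simp] theorem update_tbSt_go (vt acc g go cy md tmp w : List Γ') :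
    Function.update (tbSt vt acc g go cy md tmp) TB.go w = tbSt vt acc g w cy md tmp := by
  funext r; cases r <;> rfl
/-- Updating `cy`. [folklore] -/
@[simp] theorem update_tbSt_cy (vt acc g go cy md tmp w : List Γ') :
    Function.update (tbSt vt acc g go cy md tmp) TB.cy w = tbSt vt acc g go w md tmp := by
  funext r; cases r <;> rfl
/-- Updating `md`. [folklore] -/
@[simp] theorem update_tbSt_md (vt acc g go cy md tmp w : List Γ') :
    Function.update (tbSt vt acc g go cy md tmp) TB.md w = tbSt vt acc g go cy w tmp := by
  funext r; cases r <;> rfl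
/-- Updating `tmp`. [folklore] -/
@[simp] theorem update_tbSt_tmp (vt acc g go cy md tmp w : List Γ') :
    Function.update (tbSt vt acc g go cy md tmp) TB.tmp w = tbSt vt acc g go cy md w := by
  funext r; cases r <;> rfl

/-- Every store of the bank is a `tbSt`. [folklore] -/
theorem tbSt_eta (R : AStore Γ' TB) :
    R = tbSt (R TB.vt) (R TB.acc) (R TB.g) (R TB.go) (R TB.cy) (R TB.md) (R TB.tmp) := by
  funext r; cases r <;> rfl

/-- `tbSt` is injective. [folklore] -/
@[simp] theorem tbSt_inj {vt acc g go cy md tmp vt' acc' g' go' cy' md' tmp' : List Γ'} :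
    tbSt vt acc g go cy md tmp = tbSt vt' acc' g' go' cy' md' tmp' ↔
      vt = vt' ∧ acc = acc' ∧ g = g' ∧ go = go' ∧ cy = cy' ∧ md = md' ∧ tmp = tmp' := by
  constructor
  · intro h
    exact ⟨congrFun h TB.vt, congrFun h TB.acc, congrFun h TB.g, congrFun h TB.go,
      congrFun h TB.cy, congrFun h TB.md, congrFun h TB.tmp⟩
  · rintro ⟨rfl, rfl, rfl, rfl, rfl, rfl, rfl⟩; rfl

/-- Transport of a loop segment along equalities of its word, stores and budget (a dot-notation
extension of `Literature.Computability.Complexity.ACom.SegRuns`, `SymbolPrograms.lean`).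
[folklore] -/
theorem _root_.Literature.Computability.Complexity.ACom.SegRuns.cast {Γ ι : Type} [DecidableEq ι]
    {k : ι} {f : Γ → ACom Γ ι} {u u' : List Γ} {R R' R₁ R₁' : AStore Γ ι} {B B' : ℕ}
    (h : SegRuns k f u R R₁ B) (hu : u = u') (h0 : R = R') (h1 : R₁ = R₁') (hB : B ≤ B') :
    SegRuns k f u' R' R₁' B' := by
  subst hu h0 h1; exact h.mono hB

/-- Transport of a run along equalities of its stores and budget (a dot-notation extension of
`Literature.Computability.Complexity.ACom.Runs`, `SymbolPrograms.lean`). [folklore] -/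
theorem _root_.Literature.Computability.Complexity.ACom.Runs.cast {Γ ι : Type} [DecidableEq ι]
    {c : ACom Γ ι} {R R' R₁ R₁' : AStore Γ ι} {B B' : ℕ}
    (h : Runs c R R₁ B) (h0 : R = R') (h1 : R₁ = R₁') (hB : B ≤ B') : Runs c R' R₁' B' := by
  subst h0 h1; exact h.mono hB

/-- Flip a polarity bit (other symbols unchanged). [folklore] -/
def flipSym : Γ' → Γ'
  | Γ'.bit b => Γ'.bit (!b)
  | s => s

/-- Re-arm the mode flag `md`, unless the symbol just processed closed an entry. [folklore] -/
def rearm (s : Γ') : ACom Γ' TB := if s = Γ'.comma then skip else push TB.md Γ'.blank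

/-- Body of the flip pass: the first symbol of an entry (mode flag down) is emitted flipped, the
others verbatim; every symbol is also saved on `tmp`. [folklore] -/
def flipBody (s : Γ') : ACom Γ' TB :=
  pop TB.md (fun o => (match o with
    | none => push TB.acc (flipSym s)
    | some _ => push TB.acc s) ;; push TB.tmp s ;; rearm s)

/-- `flipEmit`: push onto `acc` (reversed) the encoded clause of the literals of `vt` with
flipped polarities — for `vt = cbody (V.zip bs)` this is `encodeClause (IPRename.clauseOf V bs)` —
and restore `vt` from `tmp`. Requires `md = tmp = []`. [folklore] -/
def flipEmit : ACom Γ' TB :=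
  push TB.acc Γ'.bra ;; loop TB.vt flipBody ;; push TB.acc Γ'.ket ;; pour TB.tmp TB.vt

/-- Inside an entry (mode flag armed), non-comma symbols are copied to `acc` and `tmp`.
[folklore] -/
theorem segRuns_flipBody_inside (acc g go cy tmp : List Γ') :
    ∀ (u : List Γ'), Γ'.comma ∉ u → ∀ (rest acc' tmp' : List Γ'),
      SegRuns TB.vt flipBody u (tbSt (u ++ rest) (acc' ++ acc) g go cy [Γ'.blank] (tmp' ++ tmp))
        (tbSt rest (u.reverse ++ acc' ++ acc) g go cy [Γ'.blank] (u.reverse ++ tmp' ++ tmp))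
        (7 * u.length)
  | [], _, rest, acc', tmp' => by simpa using SegRuns.nil TB.vt flipBody _
  | a :: u, hu, rest, acc', tmp' => by
    have ha : a ≠ Γ'.comma := fun h => hu (by simp [h])
    have hu' : Γ'.comma ∉ u := fun h => hu (by simp [h])
    have hbody : Runs (flipBody a)
        (Function.update (tbSt (a :: u ++ rest) (acc' ++ acc) g go cy [Γ'.blank] (tmp' ++ tmp))
          TB.vt (u ++ rest))
        (tbSt (u ++ rest) (a :: acc' ++ acc) g go cy [Γ'.blank] (a :: tmp' ++ tmp)) 5 := by
      unfold flipBody rearm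
      rw [if_neg ha, update_tbSt_vt]
      have inner : Runs (push TB.acc a ;; push TB.tmp a ;; push TB.md Γ'.blank)
          (tbSt (u ++ rest) (acc' ++ acc) g go cy [] (tmp' ++ tmp))
          (tbSt (u ++ rest) (a :: acc' ++ acc) g go cy [Γ'.blank] (a :: tmp' ++ tmp)) 3 :=
        ((Runs.push' rfl).seq ((Runs.push' rfl).seq (Runs.push' rfl))).of_eq (by simp) (by norm_num)
      exact Runs.pop_cons (k := TB.md) (a := Γ'.blank) (w := []) rfl (by simpa using inner)
    have ih := segRuns_flipBody_inside acc g go cy tmp u hu' rest (a :: acc') (a :: tmp')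
    have hk : tbSt (a :: u ++ rest) (acc' ++ acc) g go cy [Γ'.blank] (tmp' ++ tmp) TB.vt =
        a :: (u ++ rest) := rfl
    refine (SegRuns.cons hk hbody ih).of_eq (by simp) ?_
    simp only [List.length_cons]; omega

/-- Flip the polarity of a literal (this is `Complexity.Literal.negate` of `Complexity/CNF.lean` on
`ℕ × Bool`; `KCNF` does not import that file, so the one-liner is restated). [folklore] -/
def flipLit (l : Lit) : Lit := (l.1, !l.2)

/-- The body of a flipped literal. [folklore] -/
theorem litBody_flipLit (l : Lit) : litBody (flipLit l) = flipSym (Γ'.bit l.2) :: (encodeNat l.1).map Γ'.bit := rfl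

/-- **One entry of the flip pass**: the literal is emitted flipped and saved verbatim. [folklore] -/
theorem segRuns_flipBody_entry (l : Lit) (rest acc g go cy tmp : List Γ') :
    SegRuns TB.vt flipBody (KCNF.encodeLiteral l)
      (tbSt (KCNF.encodeLiteral l ++ rest) acc g go cy [] tmp)
      (tbSt rest ((KCNF.encodeLiteral (flipLit l)).reverse ++ acc) g go cy []
        ((KCNF.encodeLiteral l).reverse ++ tmp))
      (7 * (KCNF.encodeLiteral l).length) := by
  rw [encodeLiteral_eq, encodeLiteral_eq, litBody_flipLit]
  obtain ⟨i, b⟩ := l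
  simp only [litBody]
  set bs := (encodeNat i).map Γ'.bit with hbs
  have hcomma : Γ'.comma ∉ bs := by
    rw [hbs]; simp
  -- first symbol: the polarity bit, mode register empty
  have h1 : Runs (flipBody (Γ'.bit b))
      (Function.update (tbSt (Γ'.bit b :: bs ++ [Γ'.comma] ++ rest) acc g go cy [] tmp) TB.vt
        (bs ++ [Γ'.comma] ++ rest))
      (tbSt (bs ++ [Γ'.comma] ++ rest) (Γ'.bit (!b) :: acc) g go cy [Γ'.blank] (Γ'.bit b :: tmp)) 5 := by
    unfold flipBody rearm
    rw [if_neg (by simp), update_tbSt_vt]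
    have inner : Runs (push TB.acc (flipSym (Γ'.bit b)) ;; push TB.tmp (Γ'.bit b) ;; push TB.md Γ'.blank)
        (tbSt (bs ++ [Γ'.comma] ++ rest) acc g go cy [] tmp)
        (tbSt (bs ++ [Γ'.comma] ++ rest) (Γ'.bit (!b) :: acc) g go cy [Γ'.blank] (Γ'.bit b :: tmp)) 3 :=
      ((Runs.push' rfl).seq ((Runs.push' rfl).seq (Runs.push' rfl))).of_eq (by simp [flipSym]) (by norm_num)
    exact Runs.pop_nil rfl inner
  -- the index bits
  have h2 := segRuns_flipBody_inside acc g go cy tmp bs hcomma ([Γ'.comma] ++ rest) [Γ'.bit (!b)] [Γ'.bit b]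
  -- the comma
  have h3 : Runs (flipBody Γ'.comma)
      (Function.update (tbSt ([Γ'.comma] ++ rest) (bs.reverse ++ [Γ'.bit (!b)] ++ acc) g go cy [Γ'.blank]
        (bs.reverse ++ [Γ'.bit b] ++ tmp)) TB.vt rest)
      (tbSt rest (Γ'.comma :: (bs.reverse ++ [Γ'.bit (!b)] ++ acc)) g go cy []
        (Γ'.comma :: (bs.reverse ++ [Γ'.bit b] ++ tmp))) 4 := by
    unfold flipBody rearm
    rw [if_pos rfl, update_tbSt_vt]
    have inner : Runs (push TB.acc Γ'.comma ;; push TB.tmp Γ'.comma ;; skip)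
        (tbSt rest (bs.reverse ++ [Γ'.bit (!b)] ++ acc) g go cy [] (bs.reverse ++ [Γ'.bit b] ++ tmp))
        (tbSt rest (Γ'.comma :: (bs.reverse ++ [Γ'.bit (!b)] ++ acc)) g go cy []
          (Γ'.comma :: (bs.reverse ++ [Γ'.bit b] ++ tmp))) 2 :=
      ((Runs.push' rfl).seq ((Runs.push' rfl).seq (Runs.skip _))).of_eq (by simp) (by norm_num)
    exact Runs.pop_cons (k := TB.md) (a := Γ'.blank) (w := []) rfl (by simpa using inner)
  have hk1 : tbSt (Γ'.bit b :: bs ++ [Γ'.comma] ++ rest) acc g go cy [] tmp TB.vt =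
      Γ'.bit b :: (bs ++ [Γ'.comma] ++ rest) := by simp
  have hk3 : tbSt ([Γ'.comma] ++ rest) (bs.reverse ++ [Γ'.bit (!b)] ++ acc) g go cy [Γ'.blank]
      (bs.reverse ++ [Γ'.bit b] ++ tmp) TB.vt = Γ'.comma :: rest := rfl
  have h23 := h2.append (SegRuns.single hk3 h3)
  have := SegRuns.cons hk1 h1 (h23.cast rfl (by simp) rfl le_rfl)
  refine this.cast (by simp) (by simp) ?_ ?_
  · simp [flipSym]
  · simp; omega

/-- **The flip pass over a clause body.** [folklore] -/
theorem segRuns_flipBody_cbody (g go cy : List Γ') : ∀ (L : List Lit) (rest acc tmp : List Γ'),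
    SegRuns TB.vt flipBody (cbody L)
      (tbSt (cbody L ++ rest) acc g go cy [] tmp)
      (tbSt rest ((cbody (L.map flipLit)).reverse ++ acc) g go cy [] ((cbody L).reverse ++ tmp))
      (7 * (cbody L).length)
  | [], rest, acc, tmp => by simpa using SegRuns.nil TB.vt flipBody _
  | l :: L, rest, acc, tmp => by
    have h1 := segRuns_flipBody_entry l (cbody L ++ rest) acc g go cy tmp
    have h2 := segRuns_flipBody_cbody g go cy L rest ((KCNF.encodeLiteral (flipLit l)).reverse ++ acc)
      ((KCNF.encodeLiteral l).reverse ++ tmp)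
    have := h1.append h2
    refine this.cast ?_ ?_ ?_ ?_
    · simp [cbody_cons, encodeLiteral_eq]
    · simp [cbody_cons, encodeLiteral_eq]
    · simp [cbody_cons, encodeLiteral_eq, flipLit]
    · simp [cbody_cons, encodeLiteral_eq]; omega

/-- **Specification of `flipEmit`.** [folklore] -/
theorem runs_flipEmit (L : List Lit) (acc g go cy : List Γ') :
    Runs flipEmit (tbSt (cbody L) acc g go cy [] [])
      (tbSt (cbody L) ((KCNF.encodeClause (L.map flipLit)).reverse ++ acc) g go cy [] [])
      (10 * (cbody L).length + 4) := by
  unfold flipEmit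
  have h1 : Runs (push TB.acc Γ'.bra) (tbSt (cbody L) acc g go cy [] [])
      (tbSt (cbody L ++ []) (Γ'.bra :: acc) g go cy [] []) 1 := (Runs.push' (by simp))
  have h2 := (segRuns_flipBody_cbody g go cy L [] (Γ'.bra :: acc) []).runs_loop_nil rfl
  have h3 : Runs (push TB.acc Γ'.ket)
      (tbSt [] ((cbody (L.map flipLit)).reverse ++ Γ'.bra :: acc) g go cy [] ((cbody L).reverse ++ []))
      (tbSt [] (Γ'.ket :: ((cbody (L.map flipLit)).reverse ++ Γ'.bra :: acc)) g go cy []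
        ((cbody L).reverse)) 1 := Runs.push' (by simp)
  have h4 := runs_pour (a := TB.tmp) (b := TB.vt) (by decide)
    (tbSt [] (Γ'.ket :: ((cbody (L.map flipLit)).reverse ++ Γ'.bra :: acc)) g go cy [] ((cbody L).reverse))
  refine (h1.seq (h2.seq (h3.seq h4))).of_eq ?_ ?_
  · simp [encodeClause_eq]
  · simp; omega

/-- Head step of the increment at the polarity bit `b` of an entry, with the carry in `cy`: the new
bit is `b xor carry`, the new carry `b and carry`. (Knuth, TAOCP 2, §4.3.1.) [folklore] -/
def incHead : Γ' → ACom Γ' TB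
  | Γ'.bit b => pop TB.cy fun o => match o with
      | some _ => if b then (push TB.tmp (Γ'.bit false) ;; push TB.cy Γ'.blank)
          else push TB.tmp (Γ'.bit true)
      | none => push TB.tmp (Γ'.bit b)
  | s => push TB.tmp s

/-- Body of the increment pass: the head step at the first symbol of an entry, a verbatim copy to
`tmp` otherwise. [folklore] -/
def incBody (s : Γ') : ACom Γ' TB :=
  pop TB.md (fun o => (match o with
    | none => incHead s
    | some _ => push TB.tmp s) ;; rearm s)

/-- `incPass`: replace the tuple of polarities of `vt` by its binary successor (least significant
position = first entry), leaving the carry out in `cy`. Requires `cy = md = tmp = []`. [folklore] -/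
def incPass : ACom Γ' TB := push TB.cy Γ'.blank ;; loop TB.vt incBody ;; pour TB.tmp TB.vt

/-- The literal list after the ripple-carry increment of its polarity bits with carry-in `c`.
[folklore] -/
def incLits : Bool → List Lit → List Lit
  | _, [] => []
  | c, l :: L => (l.1, xor l.2 c) :: incLits (l.2 && c) L

/-- The carry out of that increment. [folklore] -/
def carryOut : Bool → List Lit → Bool
  | c, [] => c
  | c, l :: L => carryOut (l.2 && c) L

/-- `incLits` on the empty list. [folklore] -/
@[simp] theorem incLits_nil (c : Bool) : incLits c [] = [] := by cases c <;> rfl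
/-- `incLits` on a cons: the head bit absorbs the carry. [folklore] -/
@[simp] theorem incLits_cons (c : Bool) (l : Lit) (L : List Lit) :
    incLits c (l :: L) = (l.1, xor l.2 c) :: incLits (l.2 && c) L := by cases c <;> rfl
/-- `carryOut` on the empty list. [folklore] -/
@[simp] theorem carryOut_nil (c : Bool) : carryOut c [] = c := by cases c <;> rfl
/-- `carryOut` on a cons. [folklore] -/
@[simp] theorem carryOut_cons (c : Bool) (l : Lit) (L : List Lit) :
    carryOut c (l :: L) = carryOut (l.2 && c) L := by cases c <;> rfl

/-- The increment does not change the length of the clause body. [folklore] -/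
theorem length_cbody_incLits : ∀ (c : Bool) (L : List Lit), (cbody (incLits c L)).length = (cbody L).length
  | c, [] => by simp
  | c, l :: L => by
    simp only [incLits_cons, cbody_cons, List.length_append, List.length_cons,
      length_cbody_incLits (l.2 && c) L]
    simp [litBody]

/-- The increment of the literal list is the canonical carry pass `TokConv.ib` on its polarities
(the variables are kept). [folklore] -/
theorem incLits_map : ∀ (c : Bool) (L : List Lit),
    (incLits c L).map Prod.snd = Complexity.TokConv.ib c (L.map Prod.snd) ∧
      (incLits c L).map Prod.fst = L.map Prod.fst
  | c, [] => by simp [Complexity.TokConv.ib]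
  | c, l :: L => by
    obtain ⟨h1, h2⟩ := incLits_map (l.2 && c) L
    simp [Complexity.TokConv.ib, h1, h2]

/-- The carry out of the literal list is the canonical `TokConv.co` on its polarities. [folklore] -/
theorem carryOut_eq_co : ∀ (c : Bool) (L : List Lit), carryOut c L = Complexity.TokConv.co c (L.map Prod.snd)
  | c, [] => by simp [Complexity.TokConv.co]
  | c, l :: L => by simp [Complexity.TokConv.co, carryOut_eq_co (l.2 && c) L]

/-- Inside an entry (mode flag armed), non-comma symbols are copied to `tmp`. [folklore] -/
theorem segRuns_incBody_inside (acc g go cy : List Γ') :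
    ∀ (u : List Γ'), Γ'.comma ∉ u → ∀ (rest tmp : List Γ'),
      SegRuns TB.vt incBody u (tbSt (u ++ rest) acc g go cy [Γ'.blank] tmp)
        (tbSt rest acc g go cy [Γ'.blank] (u.reverse ++ tmp)) (6 * u.length)
  | [], _, rest, tmp => by simpa using SegRuns.nil TB.vt incBody _
  | a :: u, hu, rest, tmp => by
    have ha : a ≠ Γ'.comma := fun h => hu (by simp [h])
    have hu' : Γ'.comma ∉ u := fun h => hu (by simp [h])
    have hbody : Runs (incBody a)
        (Function.update (tbSt (a :: u ++ rest) acc g go cy [Γ'.blank] tmp) TB.vt (u ++ rest))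
        (tbSt (u ++ rest) acc g go cy [Γ'.blank] (a :: tmp)) 4 := by
      unfold incBody rearm
      rw [if_neg ha, update_tbSt_vt]
      have inner : Runs (push TB.tmp a ;; push TB.md Γ'.blank)
          (tbSt (u ++ rest) acc g go cy [] tmp)
          (tbSt (u ++ rest) acc g go cy [Γ'.blank] (a :: tmp)) 2 :=
        ((Runs.push' rfl).seq (Runs.push' rfl)).of_eq (by simp) (by norm_num)
      exact Runs.pop_cons (k := TB.md) (a := Γ'.blank) (w := []) rfl (by simpa using inner)
    have ih := segRuns_incBody_inside acc g go cy u hu' rest (a :: tmp)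
    have hk : tbSt (a :: u ++ rest) acc g go cy [Γ'.blank] tmp TB.vt = a :: (u ++ rest) := rfl
    refine (SegRuns.cons hk hbody ih).cast rfl rfl (by simp) ?_
    simp only [List.length_cons]; omega

/-- **One entry of the increment pass** with carry-in `c`. [folklore] -/
theorem segRuns_incBody_entry (l : Lit) (c : Bool) (rest acc g go tmp : List Γ') :
    SegRuns TB.vt incBody (KCNF.encodeLiteral l)
      (tbSt (KCNF.encodeLiteral l ++ rest) acc g go (flagW Γ'.blank (c = true)) [] tmp)
      (tbSt rest acc g go (flagW Γ'.blank ((l.2 && c) = true)) []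
        ((KCNF.encodeLiteral (l.1, xor l.2 c)).reverse ++ tmp))
      (9 * (KCNF.encodeLiteral l).length) := by
  rw [encodeLiteral_eq, encodeLiteral_eq]
  obtain ⟨i, b⟩ := l
  simp only [litBody]
  set bs := (encodeNat i).map Γ'.bit with hbs
  have hcomma : Γ'.comma ∉ bs := by rw [hbs]; simp
  -- first symbol: the polarity bit, mode register empty, carry `c`
  have h1 : Runs (incBody (Γ'.bit b))
      (Function.update (tbSt (Γ'.bit b :: bs ++ [Γ'.comma] ++ rest) acc g go
        (flagW Γ'.blank (c = true)) [] tmp) TB.vt (bs ++ [Γ'.comma] ++ rest))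
      (tbSt (bs ++ [Γ'.comma] ++ rest) acc g go (flagW Γ'.blank ((b && c) = true)) [Γ'.blank]
        (Γ'.bit (xor b c) :: tmp)) 7 := by
    unfold incBody rearm
    rw [if_neg (by simp), update_tbSt_vt]
    refine Runs.pop_nil rfl ?_
    show Runs (incHead (Γ'.bit b) ;; push TB.md Γ'.blank) _ _ 5
    have hhead : Runs (incHead (Γ'.bit b))
        (tbSt (bs ++ [Γ'.comma] ++ rest) acc g go (flagW Γ'.blank (c = true)) [] tmp)
        (tbSt (bs ++ [Γ'.comma] ++ rest) acc g go (flagW Γ'.blank ((b && c) = true)) []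
          (Γ'.bit (xor b c) :: tmp)) 4 := by
      unfold incHead
      cases c with
      | true =>
        rw [flagW_true _ rfl]
        have inner : Runs (if b = true then (push TB.tmp (Γ'.bit false) ;; push TB.cy Γ'.blank)
              else push TB.tmp (Γ'.bit true))
            (tbSt (bs ++ [Γ'.comma] ++ rest) acc g go [] [] tmp)
            (tbSt (bs ++ [Γ'.comma] ++ rest) acc g go (flagW Γ'.blank ((b && true) = true)) []
              (Γ'.bit (xor b true) :: tmp)) 2 := by
          cases b with
          | true =>
            rw [if_pos rfl]
            exact ((Runs.push' rfl).seq (Runs.push' rfl)).of_eq (by simp) (by norm_num)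
          | false =>
            simp only [Bool.false_eq_true, ↓reduceIte]
            exact (Runs.push' rfl).of_eq (by simp) (by norm_num)
        exact Runs.pop_cons (k := TB.cy) (a := Γ'.blank) (w := []) rfl (by simpa using inner)
      | false =>
        rw [flagW_false _ (by simp)]
        have inner : Runs (push TB.tmp (Γ'.bit b))
            (tbSt (bs ++ [Γ'.comma] ++ rest) acc g go [] [] tmp)
            (tbSt (bs ++ [Γ'.comma] ++ rest) acc g go (flagW Γ'.blank ((b && false) = true)) []
              (Γ'.bit (xor b false) :: tmp)) 2 :=
          (Runs.push' rfl).of_eq (by simp) (by norm_num)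
        exact Runs.pop_nil rfl inner
    exact (hhead.seq (Runs.push' rfl)).of_eq (by simp) (by norm_num)
  -- the index bits
  have h2 := segRuns_incBody_inside acc g go (flagW Γ'.blank ((b && c) = true)) bs hcomma
    ([Γ'.comma] ++ rest) (Γ'.bit (xor b c) :: tmp)
  -- the comma
  have h3 : Runs (incBody Γ'.comma)
      (Function.update (tbSt ([Γ'.comma] ++ rest) acc g go (flagW Γ'.blank ((b && c) = true))
        [Γ'.blank] (bs.reverse ++ Γ'.bit (xor b c) :: tmp)) TB.vt rest)
      (tbSt rest acc g go (flagW Γ'.blank ((b && c) = true)) []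
        (Γ'.comma :: (bs.reverse ++ Γ'.bit (xor b c) :: tmp))) 3 := by
    unfold incBody rearm
    rw [if_pos rfl, update_tbSt_vt]
    have inner : Runs (push TB.tmp Γ'.comma ;; skip)
        (tbSt rest acc g go (flagW Γ'.blank ((b && c) = true)) [] (bs.reverse ++ Γ'.bit (xor b c) :: tmp))
        (tbSt rest acc g go (flagW Γ'.blank ((b && c) = true)) []
          (Γ'.comma :: (bs.reverse ++ Γ'.bit (xor b c) :: tmp))) 1 :=
      ((Runs.push' rfl).seq (Runs.skip _)).of_eq (by simp) (by norm_num)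
    exact Runs.pop_cons (k := TB.md) (a := Γ'.blank) (w := []) rfl (by simpa using inner)
  have hk1 : tbSt (Γ'.bit b :: bs ++ [Γ'.comma] ++ rest) acc g go (flagW Γ'.blank (c = true)) [] tmp
      TB.vt = Γ'.bit b :: (bs ++ [Γ'.comma] ++ rest) := by simp
  have hk3 : tbSt ([Γ'.comma] ++ rest) acc g go (flagW Γ'.blank ((b && c) = true)) [Γ'.blank]
      (bs.reverse ++ Γ'.bit (xor b c) :: tmp) TB.vt = Γ'.comma :: rest := rfl
  have h23 := h2.append (SegRuns.single hk3 h3)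
  have := SegRuns.cons hk1 h1 (h23.cast rfl (by simp) rfl le_rfl)
  refine this.cast (by simp) (by simp) ?_ ?_
  · simp
  · simp; omega

/-- **The increment pass over a clause body.** [folklore] -/
theorem segRuns_incBody_cbody (acc g go : List Γ') : ∀ (L : List Lit) (c : Bool) (rest tmp : List Γ'),
    SegRuns TB.vt incBody (cbody L)
      (tbSt (cbody L ++ rest) acc g go (flagW Γ'.blank (c = true)) [] tmp)
      (tbSt rest acc g go (flagW Γ'.blank (carryOut c L = true)) []
        ((cbody (incLits c L)).reverse ++ tmp))
      (9 * (cbody L).length)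
  | [], c, rest, tmp => by simpa using SegRuns.nil TB.vt incBody _
  | l :: L, c, rest, tmp => by
    have h1 := segRuns_incBody_entry l c (cbody L ++ rest) acc g go tmp
    have h2 := segRuns_incBody_cbody acc g go L (l.2 && c) rest
      ((KCNF.encodeLiteral (l.1, xor l.2 c)).reverse ++ tmp)
    have := h1.append h2
    refine this.cast ?_ ?_ ?_ ?_
    · simp [cbody_cons, encodeLiteral_eq]
    · simp [cbody_cons, encodeLiteral_eq]
    · simp [cbody_cons, encodeLiteral_eq]
    · simp [cbody_cons, encodeLiteral_eq]; omega

/-- **Specification of `incPass`.** [folklore] -/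
theorem runs_incPass (L : List Lit) (acc g go : List Γ') :
    Runs incPass (tbSt (cbody L) acc g go [] [] [])
      (tbSt (cbody (incLits true L)) acc g go (flagW Γ'.blank (carryOut true L = true)) [] [])
      (12 * (cbody L).length + 3) := by
  unfold incPass
  have h1 : Runs (push TB.cy Γ'.blank) (tbSt (cbody L) acc g go [] [] [])
      (tbSt (cbody L ++ []) acc g go (flagW Γ'.blank (true = true)) [] []) 1 :=
    Runs.push' (by simp [flagW])
  have h2 := (segRuns_incBody_cbody acc g go L true [] []).runs_loop_nil rfl
  have h3 := runs_pour (a := TB.tmp) (b := TB.vt) (by decide)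
    (tbSt [] acc g go (flagW Γ'.blank (carryOut true L = true)) [] ((cbody (incLits true L)).reverse ++ []))
  refine (h1.seq (h2.seq h3)).of_eq ?_ ?_
  · simp
  · simp [length_cbody_incLits]; omega

/-- Without carry-in nothing changes. [folklore] -/
theorem incLits_false_zip : ∀ (V : List ℕ) (bs : List Bool),
    incLits false (V.zip bs) = V.zip bs ∧ carryOut false (V.zip bs) = false
  | [], bs => by simp
  | v :: V, [] => by simp
  | v :: V, b :: bs => by
    obtain ⟨h1, h2⟩ := incLits_false_zip V bs
    simp [h1, h2]

/-- **The pass computes the binary successor** of the tuple of polarities (`IPRename.bsucc`).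
[folklore] -/
theorem incLits_true_zip : ∀ (V : List ℕ) (bs : List Bool), bs.length = V.length →
    incLits true (V.zip bs) = V.zip (bsucc bs).1 ∧ carryOut true (V.zip bs) = (bsucc bs).2
  | [], [], _ => by simp
  | v :: V, b :: bs, h => by
    have h' : bs.length = V.length := by simpa using h
    cases b with
    | false =>
      obtain ⟨h1, h2⟩ := incLits_false_zip V bs
      simp [h1, h2]
    | true =>
      obtain ⟨h1, h2⟩ := incLits_true_zip V bs h'
      simp [h1, h2]
  | [], _ :: _, h => by simp at h
  | _ :: _, [], h => by simp at h

/-- Flipping the polarities of `V.zip bs` gives `IPRename.clauseOf V bs`. [folklore] -/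
theorem map_flipLit_zip (V : List ℕ) (bs : List Bool) : (V.zip bs).map flipLit = clauseOf V bs := by
  rw [clauseOf_eq_map_zip]; rfl

/-- The length of the register `vt` during the loop, a function of the variable list alone:
`Σ_v (|encodeNat v| + 2)`. [folklore] -/
def idxLen (V : List ℕ) : ℕ := (V.map fun v => (encodeNat v).length + 2).sum

/-- The length of `cbody (V.zip bs)` is `idxLen V`. [folklore] -/
theorem length_cbody_zip : ∀ (V : List ℕ) (bs : List Bool), bs.length = V.length →
    (cbody (V.zip bs)).length = idxLen V
  | [], [], _ => rfl
  | v :: V, b :: bs, h => by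
    have h' : bs.length = V.length := by simpa using h
    rw [List.zip_cons_cons, cbody_cons, List.length_append, List.length_cons,
      length_cbody_zip V bs h']
    simp [idxLen, litBody]; omega
  | [], _ :: _, h => by simp at h
  | _ :: _, [], h => by simp at h

/-- After the evaluator: emit the clause unless the flag `g` is raised (consuming the flag),
increment the tuple, and re-arm `go` unless the increment carried out. [folklore] -/
def afterEval : ACom Γ' TB :=
  pop TB.g (fun o => match o with
    | some _ => skip
    | none => flipEmit) ;;
  incPass ;;
  pop TB.cy (fun o => match o with
    | some _ => skip
    | none => push TB.go Γ'.blank)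

/-- **Specification of `afterEval`.** [folklore] -/
theorem runs_afterEval (L : List Lit) (p : Prop) [Decidable p] (acc : List Γ') :
    Runs afterEval (tbSt (cbody L) acc (flagW Γ'.blank p) [] [] [] [])
      (tbSt (cbody (incLits true L))
        (if p then acc else (KCNF.encodeClause (L.map flipLit)).reverse ++ acc) []
        (flagW Γ'.blank (¬ carryOut true L = true)) [] [] [])
      (22 * (cbody L).length + 12) := by
  unfold afterEval
  set acc' := (if p then acc else (KCNF.encodeClause (L.map flipLit)).reverse ++ acc) with hacc'
  have h1 : Runs (pop TB.g (fun o => match o with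
      | some _ => skip
      | none => flipEmit)) (tbSt (cbody L) acc (flagW Γ'.blank p) [] [] [] [])
      (tbSt (cbody L) acc' [] [] [] [] []) (10 * (cbody L).length + 4 + 2) := by
    by_cases hp : p
    · rw [flagW_true _ hp, hacc', if_pos hp]
      refine Runs.pop_cons (k := TB.g) (a := Γ'.blank) (w := []) rfl ?_
      exact (Runs.skip _).of_eq (by simp) (by omega)
    · rw [flagW_false _ hp, hacc', if_neg hp]
      exact Runs.pop_nil rfl (runs_flipEmit L acc [] [] [])
  have h2 := runs_incPass L acc' [] []
  have h3 : Runs (pop TB.cy (fun o => match o with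
      | some _ => skip
      | none => push TB.go Γ'.blank))
      (tbSt (cbody (incLits true L)) acc' [] [] (flagW Γ'.blank (carryOut true L = true)) [] [])
      (tbSt (cbody (incLits true L)) acc' [] (flagW Γ'.blank (¬ carryOut true L = true)) [] [] [])
      (1 + 2) := by
    by_cases hc : carryOut true L = true
    · rw [flagW_true _ hc, flagW_false _ (not_not_intro hc)]
      refine Runs.pop_cons (k := TB.cy) (a := Γ'.blank) (w := []) rfl ?_
      exact (Runs.skip _).of_eq (by simp) (by omega)
    · rw [flagW_false _ hc, flagW_true _ hc]
      exact Runs.pop_nil rfl ((Runs.push' rfl).of_eq (by simp) le_rfl)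
  exact (h1.seq (h2.seq h3)).of_eq rfl (by omega)

section Loop

variable {κ : Type} [DecidableEq κ]

/-- **The truth-table emission loop** around an evaluator `E` — any program on the joint register
file `TB ⊕ κ` which, finding `cbody (V.zip bs)` in `vt`, raises the flag `g` iff the Boolean
function is true at the tuple `bs` and changes nothing else: starting from the all-false tuple
with `go` armed, evaluate, emit the clause `clauseOf V bs` if the function is false, step to the
next tuple, until the increment carries out after `2^{|V|}` rounds. This is how the renaming
machine writes the truth-table CNFs `IPRename.cnf (gClause …) (depClause …)` and
`IPRename.cnf (theta …) (depTheta …)` of `IPRename.reduce`. [folklore] -/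
def cnfLoop (E : ACom Γ' (TB ⊕ κ)) : ACom Γ' (TB ⊕ κ) :=
  whileLoop (Sum.inl TB.go) (E ;; afterEval.map Sum.inl)

/-- **Specification of `cnfLoop`** for an evaluator of cost `cE` answering `geval bs` at the tuple
`bs`: the loop ends with the tuple back at all-false, all flags down, and the word of the emitted
clauses `IPRename.emitted V (geval ∘ Complexity.natBits |V|) 2^{|V|}` pushed reversed onto `acc`, within
`(cE + 22 · idxLen V + 14) · 2^{|V|} + 1` steps. [folklore] -/
theorem runs_cnfLoop (E : ACom Γ' (TB ⊕ κ)) (T : AStore Γ' κ) (V : List ℕ)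
    (geval : List Bool → Bool) (cE : ℕ)
    (hE : ∀ bs : List Bool, bs.length = V.length → ∀ acc : List Γ',
      Runs E (Sum.elim (tbSt (cbody (V.zip bs)) acc [] [] [] [] []) T)
        (Sum.elim (tbSt (cbody (V.zip bs)) acc (flagW Γ'.blank (geval bs = true)) [] [] [] []) T) cE)
    (acc₀ : List Γ') :
    Runs (cnfLoop E)
      (Sum.elim (tbSt (cbody (V.zip (List.replicate V.length false))) acc₀ [] [Γ'.blank] [] [] []) T)
      (Sum.elim (tbSt (cbody (V.zip (List.replicate V.length false)))
        ((wFam (emitted V (fun i => geval (Complexity.natBits V.length i)) (2 ^ V.length))).reverse ++ acc₀)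
        [] [] [] [] []) T)
      ((cE + 22 * idxLen V + 12 + 2) * 2 ^ V.length + 1) := by
  set m := V.length with hm
  set gv : ℕ → Bool := fun i => geval (Complexity.natBits m i) with hgv
  set S : ℕ → AStore Γ' (TB ⊕ κ) := fun i =>
    Sum.elim (tbSt (cbody (V.zip (Complexity.natBits m i))) ((wFam (emitted V gv i)).reverse ++ acc₀)
      [] [] [] [] []) T with hS
  have hN : 0 < 2 ^ m := Nat.two_pow_pos m
  have hgo : ∀ i, S i (Sum.inl TB.go) = [] := fun i => rfl
  have hstep : ∀ i, i < 2 ^ m → Runs (E ;; afterEval.map Sum.inl) (S i)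
      (Function.update (S (i + 1)) (Sum.inl TB.go) (if i + 1 < 2 ^ m then [Γ'.blank] else []))
      (cE + 22 * idxLen V + 12) := by
    intro i hi
    have hlen : (Complexity.natBits m i).length = V.length := by rw [Complexity.length_natBits, hm]
    have h1 := hE (Complexity.natBits m i) hlen ((wFam (emitted V gv i)).reverse ++ acc₀)
    have h2 := (runs_afterEval (V.zip (Complexity.natBits m i)) (geval (Complexity.natBits m i) = true)
      ((wFam (emitted V gv i)).reverse ++ acc₀)).inl T
    rw [length_cbody_zip V _ hlen] at h2
    refine (h1.seq h2).of_eq ?_ le_rfl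
    rw [hS]
    simp only [Sum.update_elim_inl, update_tbSt_go]
    obtain ⟨e1, e2⟩ := incLits_true_zip V (Complexity.natBits m i) hlen
    have e3 := bsucc_natBits m i
    rw [e1, e2, e3, map_flipLit_zip]
    congr 2
    · -- the accumulator
      rw [emitted_succ, wFam_append]
      simp only [hgv, hm]
      cases geval (Complexity.natBits V.length i) <;> simp [wFam]
    · -- the re-arming flag
      have : ((i + 1) % 2 ^ m = 0) ↔ ¬ (i + 1 < 2 ^ m) := by
        constructor
        · intro h hlt; rw [Nat.mod_eq_of_lt hlt] at h; omega
        · intro h; rw [show i + 1 = 2 ^ m by omega]; simp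
      by_cases hlt : i + 1 < 2 ^ m
      · rw [if_pos hlt, flagW_true]; simpa [this] using hlt
      · rw [if_neg hlt, flagW_false]; simpa [this] using hlt
  have := runs_whileLoop (Sum.inl TB.go) Γ'.blank (E ;; afterEval.map Sum.inl) S (2 ^ m)
    (cE + 22 * idxLen V + 12) hN hgo hstep
  refine this.cast ?_ ?_ le_rfl
  · rw [hS]; simp only [Sum.update_elim_inl, update_tbSt_go, natBits_zero, emitted_zero]; rfl
  · rw [hS]; simp only [natBits_two_pow]

/-- **The truth-table CNF is emitted**: with an evaluator answering `g (asg V bs)`, the loop pushes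
the word `wFam (IPRename.cnf g V)` (reversed) onto the accumulator. [folklore] -/
theorem runs_cnfLoop_cnf (E : ACom Γ' (TB ⊕ κ)) (T : AStore Γ' κ) (V : List ℕ)
    (g : (ℕ → Bool) → Bool) (cE : ℕ)
    (hE : ∀ bs : List Bool, bs.length = V.length → ∀ acc : List Γ',
      Runs E (Sum.elim (tbSt (cbody (V.zip bs)) acc [] [] [] [] []) T)
        (Sum.elim (tbSt (cbody (V.zip bs)) acc (flagW Γ'.blank (g (asg V bs) = true)) [] [] [] []) T)
        cE)
    (acc₀ : List Γ') :
    Runs (cnfLoop E)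
      (Sum.elim (tbSt (cbody (V.zip (List.replicate V.length false))) acc₀ [] [Γ'.blank] [] [] []) T)
      (Sum.elim (tbSt (cbody (V.zip (List.replicate V.length false)))
        ((wFam (cnf g V)).reverse ++ acc₀) [] [] [] [] []) T)
      ((cE + 22 * idxLen V + 12 + 2) * 2 ^ V.length + 1) := by
  rw [cnf_eq_emitted]
  exact runs_cnfLoop E T V (fun bs => g (asg V bs)) cE hE acc₀

end Loop

end Literature.Computability.FineGrained.IPRenameM
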